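import Summits.FinalStateConjecture.FinalStateConjecture.Theses.PhaseMixingCapture
import Summits.FinalStateConjecture.FinalStateConjecture.Theorems.SwallowTheDatumTargetGlue
import Summits.FinalStateConjecture.FinalStateConjecture.Theorems.SwallowTheDatumMGHDExists

/-!
# `CaptureSuffices` (item `stmt-FinalStateConjecture-9953`, route `PhaseMixingCapture`, support,
# rank 6): the cross-route closing path through `SwallowTheDatum`

`CaptureSuffices := NearExtremalKappaCapture → BulkKerrCapture → WeakCosmicCensorshipMGHD →
FinalStateConjecture` is implied by the summit statement itself
(`PhaseMixingCaptureCaptureSuffices.captureSuffices_of_finalStateConjecture`,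
Theorems/PhaseMixingCaptureCaptureSufficesReduction.lean). The sibling route `SwallowTheDatum`
decides the summit AS TYPED from its target `UniversalWitnessFamily`
(item `stmt-FinalStateConjecture-10051`; deciding theorem `SwallowTheDatum.closes`), which in turn
is reduced, sorry-free, to that route's cruxes `ParametricKerrBurial`
(`stmt-FinalStateConjecture-10052`), `KerrShieldedSettles` (`stmt-FinalStateConjecture-10054`) and
the shared support `MGHDExists` (`stmt-FinalStateConjecture-9937`) by
`Theorems.SwallowTheDatum.universalWitnessFamily_of_cruxes` (Theorems/SwallowTheDatumTargetGlue.lean),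
and `MGHDExists` is the named fact `choquetBruhat_geroch_exists_mghd_cauchy` restricted to
admissible data (`Theorems.mghdExists_of_choquetBruhatGeroch`, Theorems/SwallowTheDatumMGHDExists.lean).

This file records these implications for the item, kernel-checked and without new definitions
(companion of Theorems/PhaseMixingCaptureAssemblyCrossRoute.lean, which does the same for the
route's `Assembly` / `CaptureSufficesC2`). DEPENDENCY DRIFT 2026-08-17: route `SwallowTheDatum` was
CLOSED (retired) 2026-08-16T21:27:06Z — the summit Statement `FinalStateConjecture` was re-typed
2026-08-16T21:18Z (IsTameChristodoulouGeneric + RaysStayInClosure + IsFutureOriented), the deciding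
theorem `SwallowTheDatum.closes : UniversalWitnessFamily → FinalStateConjecture` no longer elaborates,
was ruled unrepairable by the planner (kill criterion (e): the re-typed statement excludes the burial
mechanism by design) and has left the generated route file. Its statement survives there as the
bookkeeping decl `SwallowTheDatum.Assembly := UniversalWitnessFamily → FinalStateConjecture`, no longer
provable in the tree. The three implications are therefore re-landed CONDITIONAL ON
`SwallowTheDatum.Assembly`, threaded as an explicit hypothesis `hA` (new names `…_of_assembly`; the
original unconditional names, one-line consequences of `closes`, are kept as DEPRECATED ALIASES of the
conditional theorems — Theorems files are append-only: deprecate, don't mutate):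

* `captureSuffices_of_universalWitnessFamily_of_assembly` —
  `SwallowTheDatum.Assembly → UniversalWitnessFamily → CaptureSuffices`, all three capture / censorship
  hypotheses idle;
* `captureSuffices_of_swallowTheDatum_cruxes_of_assembly` —
  `SwallowTheDatum.Assembly → ParametricKerrBurial → KerrShieldedSettles → MGHDExists → CaptureSuffices`;
* `captureSuffices_of_choquetBruhatGeroch_of_assembly` — the same with `MGHDExists` discharged from
  the named fact (CONDITIONAL also on the trust base Choquet-Bruhat–Geroch 1969, Thm. 3, undischarged
  in the tree).

So, GIVEN `SwallowTheDatum.Assembly`, the item closes the moment `stmt-FinalStateConjecture-10051` is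
proved (equivalently 10052 ∧ 10054 ∧ 9937); since the re-type that hypothesis is itself the dead link,
and the item's live path is the in-route one (`captureSuffices_of_finalStateConjecture`). This module
imports the route files and is therefore not itself a closing module.
-/

-- the doubled `FinalStateConjecture.FinalStateConjecture` path component trips dupNamespace
set_option linter.dupNamespace false

namespace Summit.FinalStateConjecture.FinalStateConjecture.Theorems.PhaseMixingCaptureCaptureSuffices

open Summit.FinalStateConjecture.FinalStateConjecture.Theses
open Summit.FinalStateConjecture.FinalStateConjecture.Theses.PhaseMixingCapture
open Literature.Geometry.Lorentzian (choquetBruhat_geroch_exists_mghd_cauchy)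

/-- **Cross-route closing path, conditional on the retired route's deciding implication**: given
`SwallowTheDatum.Assembly` (`UniversalWitnessFamily → FinalStateConjecture`, formerly the theorem
`SwallowTheDatum.closes`, unprovable in the tree since the statement re-type of 2026-08-16T21:18Z), the
target `UniversalWitnessFamily` of the sibling route (item stmt-FinalStateConjecture-10051) implies
`CaptureSuffices`, the three hypotheses of the item being dropped. [folklore] -/
theorem captureSuffices_of_universalWitnessFamily_of_assembly :
    SwallowTheDatum.Assembly →
      Summit.FinalStateConjecture.FinalStateConjecture.Theses.SwallowTheDatum.UniversalWitnessFamily →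
        CaptureSuffices :=
  fun hA hT _ _ _ ↦ hA hT

/-- **`CaptureSuffices` from the sibling route's cruxes, conditional on `SwallowTheDatum.Assembly`**:
`SwallowTheDatum.ParametricKerrBurial` (stmt-FinalStateConjecture-10052),
`SwallowTheDatum.KerrShieldedSettles` (stmt-FinalStateConjecture-10054) and the shared
`SwallowTheDatum.MGHDExists` (stmt-FinalStateConjecture-9937) imply the item, through the landed
reduction `Theorems.SwallowTheDatum.universalWitnessFamily_of_cruxes`. [folklore] -/
theorem captureSuffices_of_swallowTheDatum_cruxes_of_assembly (hA : SwallowTheDatum.Assembly)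
    (hB : SwallowTheDatum.ParametricKerrBurial) (hS : SwallowTheDatum.KerrShieldedSettles)
    (hM : SwallowTheDatum.MGHDExists) : CaptureSuffices :=
  captureSuffices_of_universalWitnessFamily_of_assembly hA
    (Theorems.SwallowTheDatum.universalWitnessFamily_of_cruxes hB hS hM)

/-- **Trust base displayed**: under `SwallowTheDatum.Assembly` and the named fact
`choquetBruhat_geroch_exists_mghd_cauchy` (Choquet-Bruhat–Geroch, CMP 14 (1969), Thm. 3 — every
smooth vacuum datum on a connected Hausdorff second countable `3`-manifold has a maximal vacuum Cauchy
development; undischarged in the tree), the two remaining cruxes `ParametricKerrBurial` and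
`KerrShieldedSettles` of `SwallowTheDatum` imply `CaptureSuffices`
(`Theorems.mghdExists_of_choquetBruhatGeroch` supplies `MGHDExists`). CONDITIONAL on both. [folklore] -/
theorem captureSuffices_of_choquetBruhatGeroch_of_assembly (hA : SwallowTheDatum.Assembly)
    (hcbg : choquetBruhat_geroch_exists_mghd_cauchy) (hB : SwallowTheDatum.ParametricKerrBurial)
    (hS : SwallowTheDatum.KerrShieldedSettles) : CaptureSuffices :=
  captureSuffices_of_swallowTheDatum_cruxes_of_assembly hA hB hS
    (Theorems.mghdExists_of_choquetBruhatGeroch hcbg)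

/-- DEPRECATED unconditional name (a one-line consequence of the retired deciding theorem
`SwallowTheDatum.closes`; conditional on `SwallowTheDatum.Assembly` since the statement re-type of
2026-08-16T21:18Z). [folklore] -/
@[deprecated captureSuffices_of_universalWitnessFamily_of_assembly (since := "2026-08-17")]
alias captureSuffices_of_universalWitnessFamily := captureSuffices_of_universalWitnessFamily_of_assembly

/-- DEPRECATED unconditional name (conditional on `SwallowTheDatum.Assembly` since the statement re-type
of 2026-08-16T21:18Z). [folklore] -/
@[deprecated captureSuffices_of_swallowTheDatum_cruxes_of_assembly (since := "2026-08-17")]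
alias captureSuffices_of_swallowTheDatum_cruxes := captureSuffices_of_swallowTheDatum_cruxes_of_assembly

/-- DEPRECATED unconditional name (conditional on `SwallowTheDatum.Assembly` since the statement re-type
of 2026-08-16T21:18Z). [folklore] -/
@[deprecated captureSuffices_of_choquetBruhatGeroch_of_assembly (since := "2026-08-17")]
alias captureSuffices_of_choquetBruhatGeroch := captureSuffices_of_choquetBruhatGeroch_of_assembly

end Summit.FinalStateConjecture.FinalStateConjecture.Theorems.PhaseMixingCaptureCaptureSuffices
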